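import Literature.Algebra.Homology.DiscreteRepExtInternalHomPullback
import Literature.NumberTheory.GaloisCohomology.RestrictedRamificationExtComparisonTateDual
import Literature.NumberTheory.GaloisRepresentations.AbsGaloisGroupCompact
import HarnessLib

/-!
# `cmp` of the `Ext` road is compatible with localisation `G_S ⇝ Γ_{K_v}`: the pull-back half of (Λ1)
# (Harari §17.2 «restriction maps `Hⁱ(G_S, M) → Hⁱ(G_v, M)`», Lemma 17.21 (a); Milne ADT I Lemma 4.12 / 4.13)

Topic `NumberTheory/GaloisCohomology`; namespace `Literature.NumberTheory.GaloisCohomology.RestrictedExt`.  Definitions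
with bodies (`localizationHom`, `localizationCoeff`) and theorems; no named fact, no instance, no notation, no
`sorry`.  Sequel of `RestrictedRamificationExtComparisonTateDual` (bsd-eis -w7 g12: the instantiated comparison
`cmp = extAddEquivRestrictedCohomologyTateDual : Extʳ_{C_{G_S}}(⟨M^{N_S}⟩, ⟨Ē_S⟩) ≃+ Hʳ(G_S, (M^D)^{N_S})`) and of
`DiscreteRepExtInternalHomPullback` (bsd-eis -w7 g13: door-c4's comparison commutes with pull-back along ANY continuous
homomorphism and a coefficient map, `extIhomAddEquivContinuousCohomology_resDHom`).

THE MATHEMATICS.  Let `v` be a place of the number field `K` and `φ_v : Γ_{K_v} → Γ_K ↠ G_S` (`localizationHom`).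
(1) The lane's localisation `restrictedLocalization ρ S v r : Hʳ(G_S, M^{N_S}) → Hʳ(K_v, M)` («loc ∘ inf») IS Mathlib's
`ContinuousCohomology.map φ_v ι` for the inclusion `ι : M^{N_S} ⊆ M` read over `Γ_{K_v}` (`restrictedLocalization_eq_map`,
by `ContinuousCohomology.map_comp`).  (2) For any `G ∈ C_{Γ_{K_v}}` on which `n •` is onto (e.g. `K̄_vˣ`), any coefficient
map `c : φ_v^* Ē_S ⟶ G` in `C_{Γ_{K_v}}` and any topological model `YH ≅ Hom(φ_v^* M^{N_S}, G)` with its map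
`g : φ_v^*((M^D)^{N_S}) ⟶ YH` («`Hom(M^{N_S}, c)`», hypothesis `hg`):
  `Hʳ(φ_v, g) (cmp y) = cmp_v (c_* (φ_v^* y))`  for `y ∈ Extʳ_{C_{G_S}}(⟨M^{N_S}⟩, ⟨Ē_S⟩)`
(`extAddEquivRestrictedCohomologyTateDual_resDHom`), where `cmp_v` is -w7 g12's object-level torsion comparison over
`Γ_{K_v}` (`extAddEquivContinuousCohomologyOfTorsion`).  This is the `cmp`-half of hypothesis (Λ1) of
`PoitouTateRestrictedShaTwoLocalCriterion` on the `Ext` road; the remaining half is the choice of `G = 𝔾_{m,v}`,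
`c = pr_v ∘ φ_v^*(Ē_S → Ī_S)` and `YH = M^D|_{Γ_{K_v}}` by the owner of (Λ)/(Λ2) (bsd-eis -w4).
HONEST FRAMING: homological bookkeeping; no duality theorem and no case of BSD is proved here.

## References
* D. Harari, *Galois Cohomology and Class Field Theory*, Universitext (2020), §17.2 (p. 290: restriction maps
  `Hⁱ(G_S, M) → Hⁱ(G_v, M)`), Lemma 17.21 (a), §1.5 Definition 1.33 (compatible pairs). [Harari2020]
* J. S. Milne, *Arithmetic Duality Theorems*, 2nd ed. (2006), I §4: Lemma 4.12, Lemma 4.13, proof of Thm. 4.10 (a)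
  (p. 58). [MilneADT2006]
-/

noncomputable section

open CategoryTheory CategoryTheory.Abelian NumberField Field IsDedekindDomain
open Literature.Algebra.Homology Literature.Algebra.Homology.DiscreteRep
open Literature.NumberTheory.GaloisRepresentations
open scoped NumberField

namespace Literature.NumberTheory.GaloisCohomology

namespace RestrictedExt

/-! ## §1 `restrictedLocalization` is ONE `ContinuousCohomology.map` along `φ_v : Γ_{K_v} → G_S` -/

section Localization

variable (K : Type) [Field K] [NumberField K] (S : Set (HeightOneSpectrum (𝓞 K))) (v : Place K)

/-- **`φ_v : Γ_{K_v} → Γ_K ↠ G_S`**, the continuous homomorphism along which the lane localises (the tree's fixed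
`absGaloisRestrict K K_v` followed by the quotient map). [cite: Harari2020, §17.2 (p. 290)] -/
abbrev localizationHom : absoluteGaloisGroup (Place.Completion v) →ₜ* GaloisGroupUnramifiedOutside K S :=
  (ContinuousMonoidHom.quotientMk (ramificationSubgroup K S)).comp (absGaloisRestrict K (Place.Completion v))

/-- Unfolding `localizationHom`. [cite: Harari2020, §17.2 (p. 290)] -/
@[simp] theorem localizationHom_apply (σ : absoluteGaloisGroup (Place.Completion v)) :
    localizationHom K S v σ = (absGaloisRestrict K (Place.Completion v) σ : GaloisGroupUnramifiedOutside K S) := rfl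

/-- At a finite place `v`, read on the `v`-adic completion: `φ_v = (Γ_K ↠ G_S) ∘ res_v` as a bare monoid homomorphism
(definitionally; this is the form `decompMapS` used by the `S`-idèle localisation files of the lane, so that
`pullD ℤ (localizationHom K S (Sum.inr v))` and `resDHom ℤ ((toUnramifiedQuot K S).comp res_v) _` agree by `rfl`).
[cite: Harari2020, §17.2 (p. 290) and Lemma 17.23] -/
theorem coe_localizationHom_inr (v : HeightOneSpectrum (𝓞 K)) :
    ((localizationHom K S (Sum.inr v) :
        absoluteGaloisGroup (Place.Completion (K := K) (Sum.inr v)) →* GaloisGroupUnramifiedOutside K S) :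
        absoluteGaloisGroup (v.adicCompletion K) →* GaloisGroupUnramifiedOutside K S) =
      (toUnramifiedQuot K S).comp
        (absGaloisRestrict K (v.adicCompletion K) : absoluteGaloisGroup (v.adicCompletion K) →* absoluteGaloisGroup K) :=
  rfl

variable {K S} {M : Type} [AddCommGroup M] [TopologicalSpace M] [DiscreteTopology M] (ρ : DiscreteGaloisModule K M)

/-- The coefficient map of the inflation `Hʳ(G_S, M^{N_S}) → Hʳ(K, M)`: the inclusion `M^{N_S} ⊆ M` over `Γ_K` (as in
the tree's `galoisCohomology.inf`). [cite: Harari2020, §17.2 (p. 290)] -/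
def infCoeff :
    TopRep.res (ContinuousMonoidHom.quotientMk (ramificationSubgroup K S) :
        absoluteGaloisGroup K →* GaloisGroupUnramifiedOutside K S)
        (ρ.quotientInvariants (ramificationSubgroup K S)).toTopRep ⟶ ρ.toTopRep :=
  TopRep.ofHom ⟨Submodule.subtypeL _, fun _ => rfl⟩

/-- The coefficient map of the restriction `Hʳ(K, M) → Hʳ(K_v, M)`: the identity of `M` over `Γ_{K_v}` (as in the
tree's `galoisCohomology.pullback`). [cite: Harari2020, §17.2 (p. 290)] -/
def resCoeff :
    TopRep.res (absGaloisRestrict K (Place.Completion v) : absoluteGaloisGroup (Place.Completion v) →* absoluteGaloisGroup K)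
        ρ.toTopRep ⟶ (ρ.toLocal v).toTopRep :=
  TopRep.ofHom ⟨ContinuousLinearMap.id ℤ M, fun _ => rfl⟩

/-- **The coefficient map of the localisation**: the inclusion `M^{N_S} ⊆ M`, as a morphism of topological
`Γ_{K_v}`-representations `φ_v^*(M^{N_S}) ⟶ M|_{Γ_{K_v}}` (written, as in Mathlib's `ContinuousCohomology.map_comp`,
as `res_{Γ_{K_v}}(infCoeff) ≫ resCoeff`). [cite: Harari2020, §17.2 (p. 290)] -/
def localizationCoeff :
    TopRep.res (localizationHom K S v : absoluteGaloisGroup (Place.Completion v) →* GaloisGroupUnramifiedOutside K S)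
        (ρ.quotientInvariants (ramificationSubgroup K S)).toTopRep ⟶
      (ρ.toLocal v).toTopRep :=
  (TopRep.resFunctor (absGaloisRestrict K (Place.Completion v) :
      absoluteGaloisGroup (Place.Completion v) →* absoluteGaloisGroup K)).map (infCoeff ρ) ≫ resCoeff v ρ

/-- Formula: `localizationCoeff` is the inclusion `M^{N_S} ⊆ M` on vectors. [cite: Harari2020, §17.2 (p. 290)] -/
@[simp] theorem localizationCoeff_hom_apply
    (w : Representation.invariants (ρ.toRepresentation.comp (ramificationSubgroup K S).subtype)) :
    (localizationCoeff v ρ).hom w = (w : M) := rfl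

/-- **`restrictedLocalization ρ S v r` («loc_v ∘ inf») is Mathlib's `ContinuousCohomology.map φ_v (localizationCoeff)`**
(`ContinuousCohomology.map_comp`). [cite: Harari2020, §17.2 (p. 290)][cite: MilneADT2006, I §4 (p. 55)] -/
theorem restrictedLocalization_eq_map (r : ℕ) (c : ρ.restrictedCohomology S r) :
    ρ.restrictedLocalization S v r c = (ContinuousCohomology.map (localizationHom K S v) (localizationCoeff v ρ) r).hom c := by
  have h := ContinuousCohomology.map_comp (ContinuousMonoidHom.quotientMk (ramificationSubgroup K S))
    (absGaloisRestrict K (Place.Completion v)) (infCoeff ρ) (resCoeff v ρ) r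
  exact (congrArg (fun T => TopModuleCat.Hom.hom T c) h).symm

end Localization

/-! ## §2 `cmp` commutes with pull-back to `Γ_{K_v}` and a coefficient map -/

section TateDual

variable (K : Type) [Field K] [NumberField K] (S : Set (HeightOneSpectrum (𝓞 K))) (n : ℕ) [NeZero n]
  {M : Type} [AddCommGroup M] [TopologicalSpace M] [DiscreteTopology M] [Finite M] (ρ : DiscreteGaloisModule K M)
  (v : Place K) [CompactSpace (absoluteGaloisGroup (Place.Completion v))]

omit [NeZero n] [CompactSpace (absoluteGaloisGroup (Place.Completion v))] in
/-- `φ_v^* ⟨M^{N_S}⟩` is finitely generated over `ℤ` (same vectors as `⟨M^{N_S}⟩`; stated on the `Module ℤ` structure the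
object carries, as door-c4's comparison expects it). [cite: Harari2020, §16.2 Remark 16.13] -/
theorem moduleFinite_pullD_quotientInvariants :
    @Module.Finite ℤ ((pullD ℤ (localizationHom K S v)).obj
        (ofContinuousRep (ρ.quotientInvariants (ramificationSubgroup K S)))).obj.V _ _
      ((pullD ℤ (localizationHom K S v)).obj (ofContinuousRep (ρ.quotientInvariants (ramificationSubgroup K S)))).obj.hV2 :=
  moduleFinite_pullD (localizationHom K S v) (ofContinuousRep (ρ.quotientInvariants (ramificationSubgroup K S)))

attribute [local instance] moduleFinite_pullD_quotientInvariants

/-- **THE PULL-BACK HALF OF (Λ1): `cmp` COMMUTES WITH `φ_v^*` AND A COEFFICIENT MAP.**  For `M` finite `n`-torsion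
unramified outside `S ⊇ S_n`, `φ_v = localizationHom K S v`, any `G ∈ C_{Γ_{K_v}}` with `n •` onto its carrier, any
`c : φ_v^* ⟨Ē_S⟩ ⟶ G`, any discrete topological `YH` with `eH : YH ≅ Hom(φ_v^* ⟨M^{N_S}⟩, G)` and any
`g : φ_v^*((M^D)^{N_S}) ⟶ YH` lying over `Hom(M^{N_S}, c)` through `e_S` and `eH` (`hg`):
`Hʳ(φ_v, g) (cmp y) = cmp_v (φ_v^* y ∘ c)`, `cmp = extAddEquivRestrictedCohomologyTateDual`, `cmp_v` the object-level
torsion comparison over `Γ_{K_v}`.  (Instance `CompactSpace Γ_{K_v}`: `absoluteGaloisGroup_compactSpace _`.)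
[cite: Harari2020, Lemma 17.21 (a) and §17.2 (p. 290)][cite: MilneADT2006, I Lemma 4.12, Lemma 4.13] -/
theorem extAddEquivRestrictedCohomologyTateDual_resDHom
    (hn : ∀ w : HeightOneSpectrum (𝓞 K), ((n : ℕ) : 𝓞 K) ∈ w.asIdeal → w ∈ S)
    (hM : ∀ m : M, n • m = 0) (hur : ramificationSubgroup K S ≤ ContinuousRep.ker ρ)
    (G : DiscreteRepCat ℤ (absoluteGaloisGroup (Place.Completion v))) (hGm : ∀ x : G.obj.V, ∃ y, x = n • y)
    (c : (pullD ℤ (localizationHom K S v)).obj (ofContinuousRep (SUnits.sUnitsRestricted K S)) ⟶ G)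
    (YH : TopRep.{0} ℤ (absoluteGaloisGroup (Place.Completion v))) [DiscreteTopology YH.V]
    (hYH : IsDiscrete ((forgetTop ℤ (absoluteGaloisGroup (Place.Completion v))).obj YH))
    (eH : stdBase YH hYH ≅
      ihomObj ((pullD ℤ (localizationHom K S v)).obj (ofContinuousRep (ρ.quotientInvariants (ramificationSubgroup K S)))) G)
    (g : TopRep.res (localizationHom K S v : absoluteGaloisGroup (Place.Completion v) →* GaloisGroupUnramifiedOutside K S)
        ((ρ.tateDual n).quotientInvariants (ramificationSubgroup K S)).toTopRep ⟶ YH)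
    (hg : pullbackHomD (localizationHom K S v) (isDiscrete_quotientInvariants (ρ.tateDual n) S) hYH g ≫ eH.hom =
      (pullD ℤ (localizationHom K S v)).map (tateDualSUnitsIsoD K S n ρ hn hM hur).hom ≫
        (pullIhomIso (localizationHom K S v) (ofContinuousRep (ρ.quotientInvariants (ramificationSubgroup K S)))
            (ofContinuousRep (SUnits.sUnitsRestricted K S))).hom ≫
          (ihomFunctor ((pullD ℤ (localizationHom K S v)).obj
            (ofContinuousRep (ρ.quotientInvariants (ramificationSubgroup K S))))).map c)
    (r : ℕ) (y : Ext (ofContinuousRep (ρ.quotientInvariants (ramificationSubgroup K S)))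
      (ofContinuousRep (SUnits.sUnitsRestricted K S)) r) :
    (ContinuousCohomology.map (localizationHom K S v) g r).hom (extAddEquivRestrictedCohomologyTateDual K S n ρ hn hM hur r y) =
      extAddEquivContinuousCohomologyOfTorsion
        ((pullD ℤ (localizationHom K S v)).obj (ofContinuousRep (ρ.quotientInvariants (ramificationSubgroup K S)))) G
        (nsmul_obj_ofContinuousRep_quotientInvariants_eq_zero K S n ρ hM) hGm YH hYH eH r
        ((y.mapExactFunctor (pullD ℤ (localizationHom K S v))).comp (Ext.mk₀ c) (add_zero r)) := by
  haveI := discreteTopology_discTopRep (ofContinuousRep (SUnits.sUnitsRestricted K S))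
  haveI := discreteTopology_discTopRep G
  have hc := pullbackHomD_homOfPullbackD (localizationHom K S v)
    (isDiscrete_discTopRep (ofContinuousRep (SUnits.sUnitsRestricted K S))) (isDiscrete_discTopRep G) c
  have h := extIhomAddEquivContinuousCohomology_resDHom (localizationHom K S v)
    (ofContinuousRep (ρ.quotientInvariants (ramificationSubgroup K S)))
    (isDiscrete_discTopRep (ofContinuousRep (SUnits.sUnitsRestricted K S))) (isDiscrete_discTopRep G)
    (homOfPullbackD (localizationHom K S v)
      (isDiscrete_discTopRep (ofContinuousRep (SUnits.sUnitsRestricted K S))) (isDiscrete_discTopRep G) c)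
    (ext_stdComplex_X_eq_zero_of_torsion (ofContinuousRep (ρ.quotientInvariants (ramificationSubgroup K S)))
      (discTopRep (ofContinuousRep (SUnits.sUnitsRestricted K S)))
      (isDiscrete_discTopRep (ofContinuousRep (SUnits.sUnitsRestricted K S)))
      (nsmul_obj_ofContinuousRep_quotientInvariants_eq_zero K S n ρ hM)
      (exists_eq_nsmul_sUnitsRestricted_of_mem K S n (NeZero.ne n) hn))
    (ext_stdComplex_X_eq_zero_of_torsion
      ((pullD ℤ (localizationHom K S v)).obj (ofContinuousRep (ρ.quotientInvariants (ramificationSubgroup K S))))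
      (discTopRep G) (isDiscrete_discTopRep G)
      (nsmul_obj_ofContinuousRep_quotientInvariants_eq_zero K S n ρ hM) hGm)
    (isDiscrete_quotientInvariants (ρ.tateDual n) S) (tateDualSUnitsIsoD K S n ρ hn hM hur) hYH eH g
    (hg.trans (congrArg (fun t => (pullD ℤ (localizationHom K S v)).map (tateDualSUnitsIsoD K S n ρ hn hM hur).hom ≫
      (pullIhomIso (localizationHom K S v) (ofContinuousRep (ρ.quotientInvariants (ramificationSubgroup K S)))
          (ofContinuousRep (SUnits.sUnitsRestricted K S))).hom ≫
        (ihomFunctor ((pullD ℤ (localizationHom K S v)).obj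
          (ofContinuousRep (ρ.quotientInvariants (ramificationSubgroup K S))))).map t) hc.symm)) r y
  rw [hc] at h
  exact h

/-- **Corollary — the form consumed by (Λ1)**: with the topological model `YH := (M^D)|_{Γ_{K_v}}` and
`g := localizationCoeff` (so that `Hʳ(φ_v, g)` IS `restrictedLocalization (ρ.tateDual n) S v r`,
`restrictedLocalization_eq_map`), for any `eH : (M^D)|_{Γ_{K_v}} ≅ Hom(φ_v^* ⟨M^{N_S}⟩, G)` compatible with `e_S` and `c`:
`restrictedLocalization (ρ.tateDual n) S v r (cmp y) = cmp_v (φ_v^* y ∘ c)`.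
[cite: Harari2020, Lemma 17.21 (a) and §17.2 (p. 290)][cite: MilneADT2006, I Lemma 4.13, Thm. 4.10 (a) (proof, p. 58)] -/
theorem restrictedLocalization_extAddEquivRestrictedCohomologyTateDual
    (hn : ∀ w : HeightOneSpectrum (𝓞 K), ((n : ℕ) : 𝓞 K) ∈ w.asIdeal → w ∈ S)
    (hM : ∀ m : M, n • m = 0) (hur : ramificationSubgroup K S ≤ ContinuousRep.ker ρ)
    (G : DiscreteRepCat ℤ (absoluteGaloisGroup (Place.Completion v))) (hGm : ∀ x : G.obj.V, ∃ y, x = n • y)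
    (c : (pullD ℤ (localizationHom K S v)).obj (ofContinuousRep (SUnits.sUnitsRestricted K S)) ⟶ G)
    (eH : stdBase ((ρ.tateDual n).toLocal v).toTopRep (isDiscrete_of_continuousRep ((ρ.tateDual n).toLocal v)) ≅
      ihomObj ((pullD ℤ (localizationHom K S v)).obj (ofContinuousRep (ρ.quotientInvariants (ramificationSubgroup K S)))) G)
    (hg : pullbackHomD (localizationHom K S v) (isDiscrete_quotientInvariants (ρ.tateDual n) S)
          (isDiscrete_of_continuousRep ((ρ.tateDual n).toLocal v)) (localizationCoeff v (ρ.tateDual n)) ≫ eH.hom =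
      (pullD ℤ (localizationHom K S v)).map (tateDualSUnitsIsoD K S n ρ hn hM hur).hom ≫
        (pullIhomIso (localizationHom K S v) (ofContinuousRep (ρ.quotientInvariants (ramificationSubgroup K S)))
            (ofContinuousRep (SUnits.sUnitsRestricted K S))).hom ≫
          (ihomFunctor ((pullD ℤ (localizationHom K S v)).obj
            (ofContinuousRep (ρ.quotientInvariants (ramificationSubgroup K S))))).map c)
    (r : ℕ) (y : Ext (ofContinuousRep (ρ.quotientInvariants (ramificationSubgroup K S)))
      (ofContinuousRep (SUnits.sUnitsRestricted K S)) r) :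
    (ρ.tateDual n).restrictedLocalization S v r (extAddEquivRestrictedCohomologyTateDual K S n ρ hn hM hur r y) =
      extAddEquivContinuousCohomologyOfTorsion
        ((pullD ℤ (localizationHom K S v)).obj (ofContinuousRep (ρ.quotientInvariants (ramificationSubgroup K S)))) G
        (nsmul_obj_ofContinuousRep_quotientInvariants_eq_zero K S n ρ hM) hGm
        ((ρ.tateDual n).toLocal v).toTopRep (isDiscrete_of_continuousRep ((ρ.tateDual n).toLocal v)) eH r
        ((y.mapExactFunctor (pullD ℤ (localizationHom K S v))).comp (Ext.mk₀ c) (add_zero r)) := by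
  rw [restrictedLocalization_eq_map]
  exact extAddEquivRestrictedCohomologyTateDual_resDHom K S n ρ v hn hM hur G hGm c
    ((ρ.tateDual n).toLocal v).toTopRep (isDiscrete_of_continuousRep ((ρ.tateDual n).toLocal v)) eH
    (localizationCoeff v (ρ.tateDual n)) hg r y

end TateDual

end RestrictedExt

end Literature.NumberTheory.GaloisCohomology

end
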